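import Summits.CriticalPhenomena.PercolationContinuityZ3.Theorems.PercAnnulusCrossingSlabCrossingBridge
import Summits.CriticalPhenomena.PercolationContinuityZ3.Theorems.PercAnnulusCrossingSlabBoxCrossingCovering
import Literature.Probability.Percolation.SlabBoxCrossingProperty
import Literature.Probability.Percolation.SlabRSWLemma311
import HarnessLib

/-!
# RSW3 lane (lead GEN 38): HALVING AND GEOMETRIC DECAY OF `f_p(m, h)` IN THE WIDTH, IN NTW VOCABULARY

builds on p205010 (kernel theorem, internal audit signed; external expert review pending) — NOT used in this file.

Cell `prim-rsw3` (LANE 3), lead seat, gen 38.  Support file (`--supports stmt-CriticalPhenomena-4575`); no definitions, no sorries.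
The lane's gen-35 block-crossing inequality `real_boxCross_two_mul_add_one_le_sq` (`μ_p(boxCross ![k,2n+1,h] 1) ≤ μ_p(boxCross ![k,n,h] 1)²`:
a crossing of the doubled block crosses two independent halves) is carried through the gen-36 bridge
`real_slabConn_lr_eq_real_boxCross` to NTW's crossing probabilities: **`f_p(2n+1, h) ≤ f_p(n, h)²`** and, iterated,
**`f_p(2^j (n+1) − 1, h) ≤ f_p(n, h)^{2^j}`** — the "crossing the long way requires crossing λ disjoint hard blocks, each with
probability `≤ 1/2`" step of NTW's Theorem 3.10 ((3.72): `P[L(S₂) ⟷^{S₂} T(S₂)] ≤ 2^{−λ}`) and of Theorem 3.17, in the form the port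
(p1's square-ring design, item W5) consumes.

* `crossingProb_two_mul_add_one_le_sq`, `crossingProb_iter_le_pow`, `crossingProb_le_quarter_of_le_half`.

References: Newman–Tassion–Wu, CPAM 70 (2017) = arXiv:1512.09107, Lemma 3.12 (23) and proof of Theorem 3.10 (3.72) [NewmanTassionWu2017].
-/

noncomputable section

namespace Summit.CriticalPhenomena.PercolationContinuityZ3.Theorems.Crossing

open MeasureTheory
open Literature.Probability.Percolation Literature.Probability.LatticeModels
open Literature.Probability.Percolation.NTW17

/-- **Halving**: `f_p(2n+1, h) ≤ f_p(n, h)²` for the slab `S_k`. [cite: NewmanTassionWu2017, Lemma 3.12 eq. (23); Theorem 3.10 (proof, (3.72))] -/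
theorem crossingProb_two_mul_add_one_le_sq (k : ℕ) (p : unitInterval) (n h : ℕ) :
    crossingProb k p (2 * n + 1) h ≤ crossingProb k p n h ^ 2 := by
  rw [crossingProb_eq, crossingProb_eq]
  have h1 := real_slabConn_lr_eq_real_boxCross k (2 * n + 1) h p
  have h2 := real_slabConn_lr_eq_real_boxCross k n h p
  push_cast at h1 h2 ⊢
  rw [h1, h2]
  exact real_boxCross_two_mul_add_one_le_sq p k n h

/-- **Geometric decay in the width**: `f_p(2^j (n+1) − 1, h) ≤ f_p(n, h)^{2^j}`.
[cite: NewmanTassionWu2017, Theorem 3.10 (proof, (3.72): "must cross λ disjoint rectangles in the long direction")] -/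
theorem crossingProb_iter_le_pow (k : ℕ) (p : unitInterval) (n h : ℕ) :
    ∀ j : ℕ, crossingProb k p (2 ^ j * (n + 1) - 1) h ≤ crossingProb k p n h ^ (2 ^ j)
  | 0 => by simp
  | j + 1 => by
    have hj := crossingProb_iter_le_pow k p n h j
    have heq : 2 ^ (j + 1) * (n + 1) - 1 = 2 * (2 ^ j * (n + 1) - 1) + 1 := by
      have h1 : 1 ≤ 2 ^ j * (n + 1) := Nat.one_le_iff_ne_zero.2 (by positivity)
      have h2 : 2 ^ (j + 1) * (n + 1) = 2 * (2 ^ j * (n + 1)) := by ring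
      rw [h2]; omega
    rw [heq, pow_succ, pow_mul]
    refine (crossingProb_two_mul_add_one_le_sq k p _ h).trans ?_
    have h0 : 0 ≤ crossingProb k p (2 ^ j * (n + 1) - 1) h := by rw [crossingProb_eq]; exact measureReal_nonneg
    exact pow_le_pow_left₀ h0 hj 2

/-- In particular `f_p(n, h) ≤ 1/2 ⟹ f_p(m, h) ≤ 1/4` for every `m ≥ 2n + 1`.
[cite: NewmanTassionWu2017, Theorem 3.10 (proof, (3.71)–(3.72))] -/
theorem crossingProb_le_quarter_of_le_half (k : ℕ) (p : unitInterval) {n h m : ℕ} (hm : 2 * n + 1 ≤ m)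
    (hf : crossingProb k p n h ≤ 1 / 2) : crossingProb k p m h ≤ 1 / 4 := by
  have h0 : 0 ≤ crossingProb k p n h := by rw [crossingProb_eq]; exact measureReal_nonneg
  calc crossingProb k p m h ≤ crossingProb k p (2 * n + 1) h := crossingProb_mono p hm le_rfl
    _ ≤ crossingProb k p n h ^ 2 := crossingProb_two_mul_add_one_le_sq k p n h
    _ ≤ (1 / 2) ^ 2 := pow_le_pow_left₀ h0 hf 2
    _ = 1 / 4 := by norm_num

end Summit.CriticalPhenomena.PercolationContinuityZ3.Theorems.Crossing

end
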